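import Summits.NavierStokesRegularity.NavierStokesRegularity.Theorems.EfficiencyFloorRigidExitSaturationExit
import Summits.NavierStokesRegularity.NavierStokesRegularity.Theorems.EfficiencyFloorRigidExitReduction
import Summits.NavierStokesRegularity.NavierStokesRegularity.Theorems.EfficiencyFloorMaximiserSetRigidityOrbitL3
import Summits.NavierStokesRegularity.NavierStokesRegularity.Theorems.EfficiencyFloorMaximiserSetRigidityProfileLiouville
import Summits.NavierStokesRegularity.NavierStokesRegularity.Theorems.EfficiencyFloorBlowupEnstrophyUnbounded
import Summits.NavierStokesRegularity.NavierStokesRegularity.Theorems.EfficiencyFloorFloorOfEfficiencyDecay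
import Literature.Analysis.FluidPDE.NSSereginL3BlowupHolds
import Literature.Analysis.FluidPDE.LeraySchemePressureBounds
import HarnessLib

/-!
# Route `EfficiencyFloor`, support `RigidExit` (stmt-NavierStokesRegularity-25513) on the `ProductionEfficiencyDecay` ladder
# (stmt-NavierStokesRegularity-22866): LATE EXIT FROM THE MAXIMISER SET — a blow-up leaves every `L³`-bounded
# symmetry class for good, so under clause (a) the maximiser instants are bounded away from `T`

Helper file (`--supports stmt-NavierStokesRegularity-22866`; line `efficiency_floor`, whose informal names «the exit estimate for
the colliding-ring configuration» as the structural lemma after the budget). The landed reading of `RigidExit`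
(`…RigidExitSaturationExit`, READING) leaves two pieces: (i) ORBIT SELECTION — a classical trajectory cannot consist of
normalised maximisers on a time interval — and (ii) continuous dependence. This file settles (i) AT LATE TIMES, with no
selection of group parameters at all, by a critical-norm argument:

* `tendsto_eLpNorm_three` (§1): along every maximal classical solution on `[0,T)` that is Leray–Hopf from a rapidly decaying
  datum, `‖u(t)‖_{L³} → ∞` as `t ↑ T` — Seregin's criterion (tree theorem `seregin_L3_blowup_holds`, Seregin 2012 Thm 1.1)
  specialised to the route's class (datum in `L³` by rapid decay; sub-slab boundedness by the Tao-class cover,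
  `BlowupEnstrophyUnbounded.eLpNorm_uncurry_top_lt_top`).
* `eLpNorm_three_orbitSlice` (§2): `‖l • R (m (l • R⁻¹(· − a)))‖₃ = ‖m‖₃` — the full Navier–Stokes symmetry group
  (translations added to the landed `RotatingOrbit.eLpNorm_three_selfSimilarSlice`) acts isometrically on `L³(ℝ³)`.
* `eventually_not_orbitSlice` (§3): hence the slices `u(t)` eventually (as `t ↑ T`) lie outside the symmetry orbits of ANY
  finite family of `L³` profiles; admissible fields (`D⁰,D¹,D² ∈ L²`) are in `L³` (`memLp_three_of_admissible`).
* `eventually_not_normalisedMaximiser` / `exists_late_window_not_normalisedMaximiser` (§4): under the CLASSIFICATION half of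
  clause (a) of `MaximiserSetRigidity` (every normalised maximiser is `l • R (ms i (l • R⁻¹(· − a)))` for one of finitely many
  admissible `ms i`), there is `s₀ < T` such that NO slice `u(τ)`, `τ ∈ [s₀,T)`, is a normalised maximiser (route clause verbatim).
* `late_earlyDeficit` (§5, BY NAME): consequently the hypothesis of the landed `RigidExit.earlyDeficit_pos_of_nonMaximiser_instant`
  is met at EVERY late slice time: for the sharp constant `c⋆`, every `0 < η < 1` and every late `s` with `s + ηW(s) < T`, the
  early-deficit inequality `(1 − η + 2θ)·Z(u s)⁻² ≤ Z(u (s + ηW(s)))⁻²` holds with SOME `θ = θ(u,s) > 0`.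
* `late_strict_lerayFloor` (§5): and the sharp-static-constant Leray floor is STRICT at every late time:
  `Z(u s)⁻² < 2K(T − s)`, `K = 27c⋆⁴/(128ν³)` (rung zero `≤` is the landed `LuDoeringRung`/`FloorOfEfficiencyDecay`; strictness
  from one strict instant, `RigidExit.inv_sq_sub_lt_of_strict_instant`).
* `late_earlyDeficit_of_maximiserSetRigidity` / `late_strict_lerayFloor_of_maximiserSetRigidity`: the same from the route decl
  `Theses.EfficiencyFloor.MaximiserSetRigidity` by name (`ProfileLiouville.partA_of_maximiserSetRigidity`).

WHAT THIS SAYS. The naive enemy of the line — a blow-up that rides the Lu–Doering extremiser all the way to `T` — does not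
exist under (a): maximiser instants, and more generally instants at which the slice lies in any fixed finite union of symmetry
orbits of `H²` profiles, stay a positive time away from the blow-up time. What remains of `RigidExit` is exactly the UNIFORMITY
of the margin `θ` over `ε`-near-maximiser slices (continuous dependence in `Ḣ¹∩Ḣ²`, the READING's item (ii)) and orbit
selection at EARLY times of the maximisers' own evolutions. HONEST FRAMING: statements about a HYPOTHETICAL blow-up;
`RigidExit`, clause (a), `NearMaximiserBoundedAmplification`, `LerayFloorGap`, `ProductionEfficiencyDecay` (stmt-22866) and
Navier–Stokes regularity stay OPEN; no summit statement is proved. [folklore]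
-/

-- the problem directory repeats the summit name (`NavierStokesRegularity/NavierStokesRegularity`)
set_option linter.dupNamespace false

noncomputable section

open Set Filter MeasureTheory Topology Function
open scoped InnerProductSpace RealInnerProductSpace ENNReal NNReal
open Literature.Analysis.FluidPDE

namespace Summit.NavierStokesRegularity.NavierStokesRegularity.Theorems

namespace RigidExit

namespace LateExit

open MaximiserSetRigidity MaximiserSetRigidity.RotatingOrbit MaximiserSetRigidity.ProfileLiouville
open NearMaximiserBoundedAmplification

/-! ## §1 Seregin's criterion in the route's class: `‖u(t)‖₃ → ∞` at a first blow-up -/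

/-- An admissible field (`C^∞`, `D⁰m, D¹m, D²m ∈ L²`) is in `L³(ℝ³)` (`H² ⊂ L² ∩ L⁶ ⊂ L³`). [folklore] -/
theorem memLp_three_of_admissible {m : EuclideanSpace ℝ (Fin 3) → EuclideanSpace ℝ (Fin 3)}
    (hm : ContDiff ℝ (⊤ : ℕ∞) m) (h0 : ∫⁻ x, ‖iteratedFDeriv ℝ 0 m x‖ₑ ^ 2 < ⊤)
    (h1 : ∫⁻ x, ‖iteratedFDeriv ℝ 1 m x‖ₑ ^ 2 < ⊤) (h2 : ∫⁻ x, ‖iteratedFDeriv ℝ 2 m x‖ₑ ^ 2 < ⊤) :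
    MemLp m 3 volume := by
  have hmc : Continuous m := hm.continuous
  have h0' : ∫⁻ x, ‖m x‖ₑ ^ 2 < ⊤ := by
    refine lt_of_le_of_lt (le_of_eq (lintegral_congr fun x => ?_)) h0
    rw [← ofReal_norm, ← norm_iteratedFDeriv_zero (𝕜 := ℝ) (f := m), ofReal_norm]
  have m2 : MemLp m 2 volume :=
    (memLp_two_iff_integrable_sq_norm hmc.aestronglyMeasurable).2 (integrable_sq_norm_of_lintegral_lt_top hmc h0')
  have m6 : MemLp m 6 volume := memLp_six hm h0 h1 h2
  have h := memLp_of_memLp_two_of_memLp_six m2 m6 (k := 3) (by norm_num) (by norm_num)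
  simpa using h

/-- The datum of a maximal classical solution from a rapidly decaying datum is in `L³`. [folklore] -/
theorem memLp_three_datum {ν T : ℝ} (hT : 0 < T)
    {u : ℝ → EuclideanSpace ℝ (Fin 3) → EuclideanSpace ℝ (Fin 3)} {p : ℝ → EuclideanSpace ℝ (Fin 3) → ℝ}
    (hmax : IsMaximalSmoothSolution ν 0 u p T) (hdec : HasRapidSpatialDecay (u 0)) :
    MemLp (u 0) 3 volume :=
  memLp_three_of_admissible (hmax.isClassicalNSSolutionOn.contDiff_velocity ⟨le_rfl, hT⟩)
    (hdec.lintegral_enorm_iteratedFDeriv_sq_lt_top 0) (hdec.lintegral_enorm_iteratedFDeriv_sq_lt_top 1)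
    (hdec.lintegral_enorm_iteratedFDeriv_sq_lt_top 2)

/-- **`‖u(t)‖_{L³} → ∞` at a first blow-up** (Seregin 2012 in the route's class): along every maximal classical
solution on `[0,T)` that is Leray–Hopf from a rapidly decaying datum. [cite: Seregin2012, Comm. Math. Phys. 312 Thm. 1.1] -/
theorem tendsto_eLpNorm_three {ν T : ℝ} (hν : 0 < ν) (hT : 0 < T)
    {u : ℝ → EuclideanSpace ℝ (Fin 3) → EuclideanSpace ℝ (Fin 3)} {p : ℝ → EuclideanSpace ℝ (Fin 3) → ℝ}
    (hmax : IsMaximalSmoothSolution ν 0 u p T) (hLH : IsLerayHopfOn T ν 0 (u 0) u)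
    (hdec : HasRapidSpatialDecay (u 0)) :
    Tendsto (fun t => eLpNorm (u t) 3 volume) (𝓝[<] T) (𝓝 ⊤) :=
  seregin_L3_blowup_holds hν hT hmax hLH (memLp_three_datum hT hmax hdec)
    (BlowupEnstrophyUnbounded.eLpNorm_uncurry_top_lt_top hν hT hmax.isClassicalNSSolutionOn hLH hdec)

/-- Every finite `L³` level is eventually exceeded as `t ↑ T`. [folklore] -/
theorem eventually_lt_eLpNorm_three {ν T : ℝ} (hν : 0 < ν) (hT : 0 < T)
    {u : ℝ → EuclideanSpace ℝ (Fin 3) → EuclideanSpace ℝ (Fin 3)} {p : ℝ → EuclideanSpace ℝ (Fin 3) → ℝ}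
    (hmax : IsMaximalSmoothSolution ν 0 u p T) (hLH : IsLerayHopfOn T ν 0 (u 0) u)
    (hdec : HasRapidSpatialDecay (u 0)) {M : ℝ≥0∞} (hM : M < ⊤) :
    ∀ᶠ t in 𝓝[<] T, M < eLpNorm (u t) 3 volume :=
  (tendsto_eLpNorm_three hν hT hmax hLH hdec).eventually (lt_mem_nhds hM)

/-! ## §2 The symmetry group acts isometrically on `L³(ℝ³)` -/

/-- **`‖l • R (m (l • R⁻¹ (· − a)))‖_{L³} = ‖m‖_{L³}`** for `l > 0`, a linear isometry `R` and a translation `a`: scaling,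
rotation and translation invariance of the critical norm. [folklore] -/
theorem eLpNorm_three_orbitSlice (m : EuclideanSpace ℝ (Fin 3) → EuclideanSpace ℝ (Fin 3)) (a : EuclideanSpace ℝ (Fin 3))
    (R : EuclideanSpace ℝ (Fin 3) ≃ₗᵢ[ℝ] EuclideanSpace ℝ (Fin 3)) {l : ℝ} (hl : 0 < l) :
    eLpNorm (fun x => l • R (m (l • R.symm (x - a)))) 3 volume = eLpNorm m 3 volume := by
  have h3 : (3 : ℝ≥0∞) ≠ 0 := by norm_num
  have h3' : (3 : ℝ≥0∞) ≠ ⊤ := by norm_num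
  rw [← eLpNorm_three_selfSimilarSlice m R hl, eLpNorm_eq_lintegral_rpow_enorm_toReal h3 h3',
    eLpNorm_eq_lintegral_rpow_enorm_toReal h3 h3']
  congr 1
  exact lintegral_sub_right_eq_self (μ := volume) (fun y => ‖l • R (m (l • R.symm y))‖ₑ ^ (3 : ℝ≥0∞).toReal) a

/-! ## §3 A blow-up leaves every finite union of `L³` symmetry orbits for good -/

/-- **Late exit from `L³`-bounded symmetry classes.** For any finite family `ms` of `L³` profiles: eventually as `t ↑ T`, the
slice `u(t)` of a maximal classical Leray–Hopf rapidly-decaying-datum solution is NOT of the form `l • R (ms i (l • R⁻¹(· − a)))`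
(`l > 0`, `R` a linear isometry, `a ∈ ℝ³`). [folklore] -/
theorem eventually_not_orbitSlice {ν T : ℝ} (hν : 0 < ν) (hT : 0 < T)
    {u : ℝ → EuclideanSpace ℝ (Fin 3) → EuclideanSpace ℝ (Fin 3)} {p : ℝ → EuclideanSpace ℝ (Fin 3) → ℝ}
    (hmax : IsMaximalSmoothSolution ν 0 u p T) (hLH : IsLerayHopfOn T ν 0 (u 0) u)
    (hdec : HasRapidSpatialDecay (u 0)) {k : ℕ} (ms : Fin k → EuclideanSpace ℝ (Fin 3) → EuclideanSpace ℝ (Fin 3))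
    (h3 : ∀ i, MemLp (ms i) 3 volume) :
    ∀ᶠ t in 𝓝[<] T, ∀ (i : Fin k) (a : EuclideanSpace ℝ (Fin 3))
      (R : EuclideanSpace ℝ (Fin 3) ≃ₗᵢ[ℝ] EuclideanSpace ℝ (Fin 3)) (l : ℝ), 0 < l →
      u t ≠ fun x => l • R (ms i (l • R.symm (x - a))) := by
  set M : ℝ≥0∞ := Finset.univ.sup fun i => eLpNorm (ms i) 3 volume with hM
  have hMtop : M < ⊤ := (Finset.sup_lt_iff (by simp)).2 fun i _ => (h3 i).eLpNorm_lt_top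
  filter_upwards [eventually_lt_eLpNorm_three hν hT hmax hLH hdec hMtop] with t ht i a R l hl heq
  have hle : eLpNorm (ms i) 3 volume ≤ M := Finset.le_sup (f := fun i => eLpNorm (ms i) 3 volume) (Finset.mem_univ i)
  rw [heq, eLpNorm_three_orbitSlice (ms i) a R hl] at ht
  exact (hle.trans_lt ht).false

/-! ## §4 Under the classification half of clause (a): no maximiser slice at late times -/

/-- **No normalised-maximiser slice at late times.** Fix `c, ν₀` and suppose (the classification half of clause (a) of
`MaximiserSetRigidity`) finitely many admissible profiles `ms i` represent every normalised maximiser up to translation, linear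
isometry and scaling. Then eventually as `t ↑ T` the slice `u(t)` is NOT a normalised maximiser (route clause verbatim). [folklore] -/
theorem eventually_not_normalisedMaximiser {ν T : ℝ} (hν : 0 < ν) (hT : 0 < T)
    {u : ℝ → EuclideanSpace ℝ (Fin 3) → EuclideanSpace ℝ (Fin 3)} {p : ℝ → EuclideanSpace ℝ (Fin 3) → ℝ}
    (hmax : IsMaximalSmoothSolution ν 0 u p T) (hLH : IsLerayHopfOn T ν 0 (u 0) u)
    (hdec : HasRapidSpatialDecay (u 0)) {c ν₀ : ℝ}
    (hA : ∃ (k : ℕ) (ms : Fin k → EuclideanSpace ℝ (Fin 3) → EuclideanSpace ℝ (Fin 3)),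
      (∀ i, ContDiff ℝ (⊤ : ℕ∞) (ms i) ∧ VectorCalculus.IsDivFree (ms i) ∧ (∫⁻ x, ‖iteratedFDeriv ℝ 0 (ms i) x‖ₑ ^ 2 < ⊤) ∧
        (∫⁻ x, ‖iteratedFDeriv ℝ 1 (ms i) x‖ₑ ^ 2 < ⊤) ∧ (∫⁻ x, ‖iteratedFDeriv ℝ 2 (ms i) x‖ₑ ^ 2 < ⊤)) ∧
      ∀ m : EuclideanSpace ℝ (Fin 3) → EuclideanSpace ℝ (Fin 3), ((ContDiff ℝ (⊤ : ℕ∞) m ∧ VectorCalculus.IsDivFree m ∧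
        (∫⁻ x, ‖iteratedFDeriv ℝ 0 m x‖ₑ ^ 2 < ⊤) ∧ (∫⁻ x, ‖iteratedFDeriv ℝ 1 m x‖ₑ ^ 2 < ⊤) ∧
        (∫⁻ x, ‖iteratedFDeriv ℝ 2 m x‖ₑ ^ 2 < ⊤)) ∧ 0 < (∫ x, ‖curl m x‖ ^ 2) ∧
        (∫ x, ⟪curl m x, fderiv ℝ m x (curl m x)⟫_ℝ) = c * (∫ x, ‖curl m x‖ ^ 2) ^ (3 / 4 : ℝ) *
          (∫ x, frobeniusNormSq (fderiv ℝ (curl m) x)) ^ (3 / 4 : ℝ) ∧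
        (∫ x, frobeniusNormSq (fderiv ℝ (curl m) x)) = 81 * c ^ 4 / (256 * ν₀ ^ 4) * (∫ x, ‖curl m x‖ ^ 2) ^ 3) →
        ∃ (i : Fin k) (a : EuclideanSpace ℝ (Fin 3)) (R : EuclideanSpace ℝ (Fin 3) ≃ₗᵢ[ℝ] EuclideanSpace ℝ (Fin 3)) (l : ℝ),
          0 < l ∧ m = fun x => l • R (ms i (l • R.symm (x - a)))) :
    ∀ᶠ t in 𝓝[<] T, ¬ (((ContDiff ℝ (⊤ : ℕ∞) (u t) ∧ VectorCalculus.IsDivFree (u t) ∧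
        (∫⁻ x, ‖iteratedFDeriv ℝ 0 (u t) x‖ₑ ^ 2 < ⊤) ∧ (∫⁻ x, ‖iteratedFDeriv ℝ 1 (u t) x‖ₑ ^ 2 < ⊤) ∧
        (∫⁻ x, ‖iteratedFDeriv ℝ 2 (u t) x‖ₑ ^ 2 < ⊤)) ∧ 0 < (∫ x, ‖curl (u t) x‖ ^ 2) ∧
        (∫ x, ⟪curl (u t) x, fderiv ℝ (u t) x (curl (u t) x)⟫_ℝ) = c * (∫ x, ‖curl (u t) x‖ ^ 2) ^ (3 / 4 : ℝ) *
          (∫ x, frobeniusNormSq (fderiv ℝ (curl (u t)) x)) ^ (3 / 4 : ℝ) ∧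
        (∫ x, frobeniusNormSq (fderiv ℝ (curl (u t)) x)) = 81 * c ^ 4 / (256 * ν₀ ^ 4) * (∫ x, ‖curl (u t) x‖ ^ 2) ^ 3)) := by
  obtain ⟨k, ms, hms, hclass⟩ := hA
  have h3 : ∀ i, MemLp (ms i) 3 volume := fun i =>
    memLp_three_of_admissible (hms i).1 (hms i).2.2.1 (hms i).2.2.2.1 (hms i).2.2.2.2
  filter_upwards [eventually_not_orbitSlice hν hT hmax hLH hdec ms h3] with t ht hNM
  obtain ⟨i, a, R, l, hl, heq⟩ := hclass (u t) hNM
  exact ht i a R l hl heq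

/-- **A late window free of maximiser slices**: under the same classification hypothesis there is `s₀ ∈ (0,T)` such that NO
slice `u(τ)`, `τ ∈ [s₀, T)`, is a normalised maximiser. [folklore] -/
theorem exists_late_window_not_normalisedMaximiser {ν T : ℝ} (hν : 0 < ν) (hT : 0 < T)
    {u : ℝ → EuclideanSpace ℝ (Fin 3) → EuclideanSpace ℝ (Fin 3)} {p : ℝ → EuclideanSpace ℝ (Fin 3) → ℝ}
    (hmax : IsMaximalSmoothSolution ν 0 u p T) (hLH : IsLerayHopfOn T ν 0 (u 0) u)
    (hdec : HasRapidSpatialDecay (u 0)) {c ν₀ : ℝ}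
    (hA : ∃ (k : ℕ) (ms : Fin k → EuclideanSpace ℝ (Fin 3) → EuclideanSpace ℝ (Fin 3)),
      (∀ i, ContDiff ℝ (⊤ : ℕ∞) (ms i) ∧ VectorCalculus.IsDivFree (ms i) ∧ (∫⁻ x, ‖iteratedFDeriv ℝ 0 (ms i) x‖ₑ ^ 2 < ⊤) ∧
        (∫⁻ x, ‖iteratedFDeriv ℝ 1 (ms i) x‖ₑ ^ 2 < ⊤) ∧ (∫⁻ x, ‖iteratedFDeriv ℝ 2 (ms i) x‖ₑ ^ 2 < ⊤)) ∧
      ∀ m : EuclideanSpace ℝ (Fin 3) → EuclideanSpace ℝ (Fin 3), ((ContDiff ℝ (⊤ : ℕ∞) m ∧ VectorCalculus.IsDivFree m ∧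
        (∫⁻ x, ‖iteratedFDeriv ℝ 0 m x‖ₑ ^ 2 < ⊤) ∧ (∫⁻ x, ‖iteratedFDeriv ℝ 1 m x‖ₑ ^ 2 < ⊤) ∧
        (∫⁻ x, ‖iteratedFDeriv ℝ 2 m x‖ₑ ^ 2 < ⊤)) ∧ 0 < (∫ x, ‖curl m x‖ ^ 2) ∧
        (∫ x, ⟪curl m x, fderiv ℝ m x (curl m x)⟫_ℝ) = c * (∫ x, ‖curl m x‖ ^ 2) ^ (3 / 4 : ℝ) *
          (∫ x, frobeniusNormSq (fderiv ℝ (curl m) x)) ^ (3 / 4 : ℝ) ∧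
        (∫ x, frobeniusNormSq (fderiv ℝ (curl m) x)) = 81 * c ^ 4 / (256 * ν₀ ^ 4) * (∫ x, ‖curl m x‖ ^ 2) ^ 3) →
        ∃ (i : Fin k) (a : EuclideanSpace ℝ (Fin 3)) (R : EuclideanSpace ℝ (Fin 3) ≃ₗᵢ[ℝ] EuclideanSpace ℝ (Fin 3)) (l : ℝ),
          0 < l ∧ m = fun x => l • R (ms i (l • R.symm (x - a)))) :
    ∃ s₀ ∈ Ioo 0 T, ∀ τ ∈ Ico s₀ T, ¬ (((ContDiff ℝ (⊤ : ℕ∞) (u τ) ∧ VectorCalculus.IsDivFree (u τ) ∧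
        (∫⁻ x, ‖iteratedFDeriv ℝ 0 (u τ) x‖ₑ ^ 2 < ⊤) ∧ (∫⁻ x, ‖iteratedFDeriv ℝ 1 (u τ) x‖ₑ ^ 2 < ⊤) ∧
        (∫⁻ x, ‖iteratedFDeriv ℝ 2 (u τ) x‖ₑ ^ 2 < ⊤)) ∧ 0 < (∫ x, ‖curl (u τ) x‖ ^ 2) ∧
        (∫ x, ⟪curl (u τ) x, fderiv ℝ (u τ) x (curl (u τ) x)⟫_ℝ) = c * (∫ x, ‖curl (u τ) x‖ ^ 2) ^ (3 / 4 : ℝ) *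
          (∫ x, frobeniusNormSq (fderiv ℝ (curl (u τ)) x)) ^ (3 / 4 : ℝ) ∧
        (∫ x, frobeniusNormSq (fderiv ℝ (curl (u τ)) x)) = 81 * c ^ 4 / (256 * ν₀ ^ 4) * (∫ x, ‖curl (u τ) x‖ ^ 2) ^ 3)) := by
  have hev := eventually_not_normalisedMaximiser hν hT hmax hLH hdec hA
  obtain ⟨s₁, hs₁T, hs₁⟩ := (mem_nhdsLT_iff_exists_Ioo_subset).1 hev
  have hs₁T' : s₁ < T := hs₁T
  refine ⟨max ((s₁ + T) / 2) (T / 2), ⟨lt_max_of_lt_right (by linarith), max_lt (by linarith) (by linarith)⟩,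
    fun τ hτ => hs₁ ⟨?_, hτ.2⟩⟩
  have h1 : (s₁ + T) / 2 ≤ τ := (le_max_left _ _).trans hτ.1
  linarith


/-! ## §5 BY NAME: late early-deficit with a margin, and the strict Leray floor, under clause (a) -/

/-- **Late early deficit (for one solution, some margin).** For the sharp one-sided Lu–Doering constant `c⋆` and every
`0 < η < 1`: along every maximal classical Leray–Hopf rapidly-decaying-datum solution whose normalised maximisers (for `c⋆` and
the solution's `ν`) are classified by finitely many admissible profiles up to symmetry (classification half of clause (a)),
there is `s₀ ∈ (0,T)` such that at EVERY slice time `s ∈ [s₀,T)` with `s' = s + η·W(s) < T`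
(`W(s) = (64ν³/(27c⋆⁴))·Z(u s)⁻²`) the early-deficit inequality `(1 − η + 2θ)·Z(u s)⁻² ≤ Z(u s')⁻²` holds with SOME `θ > 0`
— the landed `earlyDeficit_pos_of_nonMaximiser_instant` fed with the non-maximiser instant `τ₀ = s`. (`θ` depends on the
solution and on `s`; its uniformity is the open content of `RigidExit`.) [folklore] -/
theorem late_earlyDeficit :
    ∃ c : ℝ, (0 < c ∧ (∀ v : EuclideanSpace ℝ (Fin 3) → EuclideanSpace ℝ (Fin 3), (ContDiff ℝ (⊤ : ℕ∞) v ∧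
      VectorCalculus.IsDivFree v ∧ (∫⁻ x, ‖iteratedFDeriv ℝ 0 v x‖ₑ ^ 2 < ⊤) ∧ (∫⁻ x, ‖iteratedFDeriv ℝ 1 v x‖ₑ ^ 2 < ⊤) ∧
      (∫⁻ x, ‖iteratedFDeriv ℝ 2 v x‖ₑ ^ 2 < ⊤)) → (∫ x, ⟪curl v x, fderiv ℝ v x (curl v x)⟫_ℝ) ≤
      c * (∫ x, ‖curl v x‖ ^ 2) ^ (3 / 4 : ℝ) * (∫ x, frobeniusNormSq (fderiv ℝ (curl v) x)) ^ (3 / 4 : ℝ)) ∧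
      ∀ c' : ℝ, (∀ w : EuclideanSpace ℝ (Fin 3) → EuclideanSpace ℝ (Fin 3), (ContDiff ℝ (⊤ : ℕ∞) w ∧
      VectorCalculus.IsDivFree w ∧ (∫⁻ x, ‖iteratedFDeriv ℝ 0 w x‖ₑ ^ 2 < ⊤) ∧ (∫⁻ x, ‖iteratedFDeriv ℝ 1 w x‖ₑ ^ 2 < ⊤) ∧
      (∫⁻ x, ‖iteratedFDeriv ℝ 2 w x‖ₑ ^ 2 < ⊤)) → (∫ x, ⟪curl w x, fderiv ℝ w x (curl w x)⟫_ℝ) ≤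
      c' * (∫ x, ‖curl w x‖ ^ 2) ^ (3 / 4 : ℝ) * (∫ x, frobeniusNormSq (fderiv ℝ (curl w) x)) ^ (3 / 4 : ℝ)) → c ≤ c') ∧
      ∀ η : ℝ, 0 < η → η < 1 → ∀ (ν T : ℝ), 0 < ν → 0 < T →
      ∀ (u : ℝ → EuclideanSpace ℝ (Fin 3) → EuclideanSpace ℝ (Fin 3)) (p : ℝ → EuclideanSpace ℝ (Fin 3) → ℝ),
      IsMaximalSmoothSolution ν 0 u p T → IsLerayHopfOn T ν 0 (u 0) u → HasRapidSpatialDecay (u 0) →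
      (∃ (k : ℕ) (ms : Fin k → EuclideanSpace ℝ (Fin 3) → EuclideanSpace ℝ (Fin 3)),
      (∀ i, ContDiff ℝ (⊤ : ℕ∞) (ms i) ∧ VectorCalculus.IsDivFree (ms i) ∧ (∫⁻ x, ‖iteratedFDeriv ℝ 0 (ms i) x‖ₑ ^ 2 < ⊤) ∧
        (∫⁻ x, ‖iteratedFDeriv ℝ 1 (ms i) x‖ₑ ^ 2 < ⊤) ∧ (∫⁻ x, ‖iteratedFDeriv ℝ 2 (ms i) x‖ₑ ^ 2 < ⊤)) ∧
      ∀ m : EuclideanSpace ℝ (Fin 3) → EuclideanSpace ℝ (Fin 3), ((ContDiff ℝ (⊤ : ℕ∞) m ∧ VectorCalculus.IsDivFree m ∧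
        (∫⁻ x, ‖iteratedFDeriv ℝ 0 m x‖ₑ ^ 2 < ⊤) ∧ (∫⁻ x, ‖iteratedFDeriv ℝ 1 m x‖ₑ ^ 2 < ⊤) ∧
        (∫⁻ x, ‖iteratedFDeriv ℝ 2 m x‖ₑ ^ 2 < ⊤)) ∧ 0 < (∫ x, ‖curl m x‖ ^ 2) ∧
        (∫ x, ⟪curl m x, fderiv ℝ m x (curl m x)⟫_ℝ) = c * (∫ x, ‖curl m x‖ ^ 2) ^ (3 / 4 : ℝ) *
          (∫ x, frobeniusNormSq (fderiv ℝ (curl m) x)) ^ (3 / 4 : ℝ) ∧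
        (∫ x, frobeniusNormSq (fderiv ℝ (curl m) x)) = 81 * c ^ 4 / (256 * ν ^ 4) * (∫ x, ‖curl m x‖ ^ 2) ^ 3) →
        ∃ (i : Fin k) (a : EuclideanSpace ℝ (Fin 3)) (R : EuclideanSpace ℝ (Fin 3) ≃ₗᵢ[ℝ] EuclideanSpace ℝ (Fin 3)) (l : ℝ),
          0 < l ∧ m = fun x => l • R (ms i (l • R.symm (x - a)))) →
      ∃ s₀ ∈ Ioo 0 T, ∀ s ∈ Ico s₀ T, s + η * (64 * ν ^ 3 / (27 * c ^ 4) * (∫ x, ‖curl (u s) x‖ ^ 2)⁻¹ ^ 2) < T →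
        ∃ θ : ℝ, 0 < θ ∧ (1 - η + 2 * θ) * (∫ x, ‖curl (u s) x‖ ^ 2)⁻¹ ^ 2 ≤
          (∫ x, ‖curl (u (s + η * (64 * ν ^ 3 / (27 * c ^ 4) * (∫ x, ‖curl (u s) x‖ ^ 2)⁻¹ ^ 2))) x‖ ^ 2)⁻¹ ^ 2 := by
  obtain ⟨c, hsharp, hED⟩ := earlyDeficit_pos_of_nonMaximiser_instant
  obtain ⟨c₁, hsharp₁, hbud⟩ := exists_budget_saturated_iff_normalisedMaximiser
  refine ⟨c, hsharp, fun η hη0 hη1 ν T hν hT u p hmax hLH hdec hA => ?_⟩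
  have hc : 0 < c := hsharp.1
  obtain ⟨s₀, hs₀, hwin⟩ := exists_late_window_not_normalisedMaximiser hν hT hmax hLH hdec hA
  refine ⟨s₀, hs₀, fun s hs hs'T => ?_⟩
  have hsI : s ∈ Ioo 0 T := ⟨hs₀.1.trans_le hs.1, hs.2⟩
  -- `Z(u s) > 0`, from the sharp budget's dictionary `∫⁻ = ofReal Zr`, `Zr = ∫`
  obtain ⟨Zr, D, hZD, -⟩ := hbud ν T hν hT u p hmax hLH hdec
  have hZpos : 0 < ∫ x, ‖curl (u s) x‖ ^ 2 := by
    have h1 := lintegral_curl_sq_pos hν hT hmax hLH hdec s ⟨hsI.1.le, hsI.2⟩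
    rw [(hZD s hsI).1] at h1
    rw [← (hZD s hsI).2.2.2.1]
    exact ENNReal.ofReal_pos.1 h1
  have hW : 0 < η * (64 * ν ^ 3 / (27 * c ^ 4) * (∫ x, ‖curl (u s) x‖ ^ 2)⁻¹ ^ 2) :=
    mul_pos hη0 (mul_pos (by positivity) (pow_pos (inv_pos.2 hZpos) 2))
  exact hED η hη0 hη1 ν T hν hT u p hmax hLH hdec s hsI hs'T s ⟨le_rfl, by linarith⟩ (hwin s hs)

/-- **Strict Leray floor at late times.** For the sharp constant `c⋆`: along every maximal classical Leray–Hopf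
rapidly-decaying-datum solution satisfying the classification half of clause (a) (for `c⋆` and its `ν`), there is
`s₀ ∈ (0,T)` with `Z(u s)⁻² < 2K·(T − s)` for ALL `s ∈ [s₀,T)`, `K = 27c⋆⁴/(128ν³)` — i.e. `Z(u s)²·(T − s) > 64ν³/(27c⋆⁴)`:
the rung-zero floor (sharp STATIC constant, landed `FloorOfEfficiencyDecay.inv_sq_le`) is never touched late. Mechanism: on
`[s₀,T)` no slice is a maximiser, so the sharp cubic law is strict at every instant (`exists_budget_saturated_iff_normalisedMaximiser`),
and one strict instant makes the integrated law strict (`inv_sq_sub_lt_of_strict_instant`). [folklore] -/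
theorem late_strict_lerayFloor :
    ∃ c : ℝ, (0 < c ∧ (∀ v : EuclideanSpace ℝ (Fin 3) → EuclideanSpace ℝ (Fin 3), (ContDiff ℝ (⊤ : ℕ∞) v ∧
      VectorCalculus.IsDivFree v ∧ (∫⁻ x, ‖iteratedFDeriv ℝ 0 v x‖ₑ ^ 2 < ⊤) ∧ (∫⁻ x, ‖iteratedFDeriv ℝ 1 v x‖ₑ ^ 2 < ⊤) ∧
      (∫⁻ x, ‖iteratedFDeriv ℝ 2 v x‖ₑ ^ 2 < ⊤)) → (∫ x, ⟪curl v x, fderiv ℝ v x (curl v x)⟫_ℝ) ≤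
      c * (∫ x, ‖curl v x‖ ^ 2) ^ (3 / 4 : ℝ) * (∫ x, frobeniusNormSq (fderiv ℝ (curl v) x)) ^ (3 / 4 : ℝ)) ∧
      ∀ c' : ℝ, (∀ w : EuclideanSpace ℝ (Fin 3) → EuclideanSpace ℝ (Fin 3), (ContDiff ℝ (⊤ : ℕ∞) w ∧
      VectorCalculus.IsDivFree w ∧ (∫⁻ x, ‖iteratedFDeriv ℝ 0 w x‖ₑ ^ 2 < ⊤) ∧ (∫⁻ x, ‖iteratedFDeriv ℝ 1 w x‖ₑ ^ 2 < ⊤) ∧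
      (∫⁻ x, ‖iteratedFDeriv ℝ 2 w x‖ₑ ^ 2 < ⊤)) → (∫ x, ⟪curl w x, fderiv ℝ w x (curl w x)⟫_ℝ) ≤
      c' * (∫ x, ‖curl w x‖ ^ 2) ^ (3 / 4 : ℝ) * (∫ x, frobeniusNormSq (fderiv ℝ (curl w) x)) ^ (3 / 4 : ℝ)) → c ≤ c') ∧
      ∀ (ν T : ℝ), 0 < ν → 0 < T →
      ∀ (u : ℝ → EuclideanSpace ℝ (Fin 3) → EuclideanSpace ℝ (Fin 3)) (p : ℝ → EuclideanSpace ℝ (Fin 3) → ℝ),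
      IsMaximalSmoothSolution ν 0 u p T → IsLerayHopfOn T ν 0 (u 0) u → HasRapidSpatialDecay (u 0) →
      (∃ (k : ℕ) (ms : Fin k → EuclideanSpace ℝ (Fin 3) → EuclideanSpace ℝ (Fin 3)),
      (∀ i, ContDiff ℝ (⊤ : ℕ∞) (ms i) ∧ VectorCalculus.IsDivFree (ms i) ∧ (∫⁻ x, ‖iteratedFDeriv ℝ 0 (ms i) x‖ₑ ^ 2 < ⊤) ∧
        (∫⁻ x, ‖iteratedFDeriv ℝ 1 (ms i) x‖ₑ ^ 2 < ⊤) ∧ (∫⁻ x, ‖iteratedFDeriv ℝ 2 (ms i) x‖ₑ ^ 2 < ⊤)) ∧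
      ∀ m : EuclideanSpace ℝ (Fin 3) → EuclideanSpace ℝ (Fin 3), ((ContDiff ℝ (⊤ : ℕ∞) m ∧ VectorCalculus.IsDivFree m ∧
        (∫⁻ x, ‖iteratedFDeriv ℝ 0 m x‖ₑ ^ 2 < ⊤) ∧ (∫⁻ x, ‖iteratedFDeriv ℝ 1 m x‖ₑ ^ 2 < ⊤) ∧
        (∫⁻ x, ‖iteratedFDeriv ℝ 2 m x‖ₑ ^ 2 < ⊤)) ∧ 0 < (∫ x, ‖curl m x‖ ^ 2) ∧
        (∫ x, ⟪curl m x, fderiv ℝ m x (curl m x)⟫_ℝ) = c * (∫ x, ‖curl m x‖ ^ 2) ^ (3 / 4 : ℝ) *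
          (∫ x, frobeniusNormSq (fderiv ℝ (curl m) x)) ^ (3 / 4 : ℝ) ∧
        (∫ x, frobeniusNormSq (fderiv ℝ (curl m) x)) = 81 * c ^ 4 / (256 * ν ^ 4) * (∫ x, ‖curl m x‖ ^ 2) ^ 3) →
        ∃ (i : Fin k) (a : EuclideanSpace ℝ (Fin 3)) (R : EuclideanSpace ℝ (Fin 3) ≃ₗᵢ[ℝ] EuclideanSpace ℝ (Fin 3)) (l : ℝ),
          0 < l ∧ m = fun x => l • R (ms i (l • R.symm (x - a)))) →
      ∃ s₀ ∈ Ioo 0 T, ∀ s ∈ Ico s₀ T, (∫ x, ‖curl (u s) x‖ ^ 2)⁻¹ ^ 2 < 2 * (27 * c ^ 4 / (128 * ν ^ 3)) * (T - s) := by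
  obtain ⟨c, hsharp, hbud⟩ := exists_budget_saturated_iff_normalisedMaximiser
  refine ⟨c, hsharp, fun ν T hν hT u p hmax hLH hdec hA => ?_⟩
  obtain ⟨s₀, hs₀, hwin⟩ := exists_late_window_not_normalisedMaximiser hν hT hmax hLH hdec hA
  obtain ⟨Zr, D, hZD, hsat⟩ := hbud ν T hν hT u p hmax hLH hdec
  set K : ℝ := 27 * c ^ 4 / (128 * ν ^ 3) with hK
  have hc : 0 < c := hsharp.1
  have hKpos : 0 < K := by positivity
  have hIoo : ∀ t ∈ Ico s₀ T, t ∈ Ioo 0 T := fun t ht => ⟨hs₀.1.trans_le ht.1, ht.2⟩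
  have hpos : ∀ t ∈ Ico s₀ T, 0 < Zr t := fun t ht => by
    have h1 := lintegral_curl_sq_pos hν hT hmax hLH hdec t ⟨(hIoo t ht).1.le, ht.2⟩
    rw [(hZD t (hIoo t ht)).1] at h1
    exact ENNReal.ofReal_pos.1 h1
  have hder : ∀ t ∈ Ico s₀ T, ∃ D' : ℝ, HasDerivAt Zr D' t ∧ D' ≤ K * Zr t ^ 3 := fun t ht =>
    ⟨D t, (hZD t (hIoo t ht)).2.2.2.2.1, (hZD t (hIoo t ht)).2.2.2.2.2.2⟩
  -- on the window the sharp cubic law is STRICT at every instant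
  have hstrict : ∀ t ∈ Ico s₀ T, D t < K * Zr t ^ 3 := fun t ht => by
    rcases ((hZD t (hIoo t ht)).2.2.2.2.2.2).lt_or_eq with h | h
    · exact h
    · exact absurd ((hsat t (hIoo t ht)).1 h) (hwin t ht)
  -- rung zero on the window: the integrated law and `Zr → ∞`
  have hlaw : ∀ s t : ℝ, s₀ ≤ s → s ≤ t → t < T → (Zr s)⁻¹ ^ 2 - (Zr t)⁻¹ ^ 2 ≤ 2 * K * (t - s) :=
    ProductionEfficiencyDecay.stub_integrateEfficiency Zr s₀ T K hpos hder
  have hU := BlowupEnstrophyUnbounded.main hν hT hmax hLH hdec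
  have hunb : ∀ s < T, ∀ N : ℝ, ∃ t ∈ Ioo s T, N ≤ Zr t := by
    intro s hs N
    have h1 := hU (max N 0)
    have h2 : ∀ᶠ t in 𝓝[<] T, t ∈ Ioo (max s 0) T := Ioo_mem_nhdsLT (max_lt hs hT)
    obtain ⟨t, hNt, ht⟩ := (h1.and h2).exists
    have htI : t ∈ Ioo 0 T := ⟨(le_max_right _ _).trans_lt ht.1, ht.2⟩
    refine ⟨t, ⟨(le_max_left _ _).trans_lt ht.1, ht.2⟩, ?_⟩
    rw [(hZD t htI).1] at hNt
    exact (le_max_left _ _).trans ((ENNReal.ofReal_le_ofReal_iff (hZD t htI).2.1).1 hNt)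
  refine ⟨s₀, hs₀, fun s hs => ?_⟩
  have hss' : s < (s + T) / 2 := by linarith [hs.2]
  have hs'T : (s + T) / 2 < T := by linarith [hs.2]
  have h1 := inv_sq_sub_lt_of_strict_instant hpos hder hs.1 le_rfl hss' hs'T
    (hZD s (hIoo s hs)).2.2.2.2.1 (hstrict s hs)
  have h2 : (Zr ((s + T) / 2))⁻¹ ^ 2 ≤ 2 * K * (T - (s + T) / 2) :=
    FloorOfEfficiencyDecay.inv_sq_le (by positivity) hlaw hunb ⟨hs.1.trans hss'.le, hs'T⟩
  rw [← (hZD s (hIoo s hs)).2.2.2.1]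
  linarith

/-- **Late early deficit from the route decl `MaximiserSetRigidity`** (stmt-25512) BY NAME: its clause (a) supplies the
classification (`ProfileLiouville.partA_of_maximiserSetRigidity`). [folklore] -/
theorem late_earlyDeficit_of_maximiserSetRigidity
    (hM : Summit.NavierStokesRegularity.NavierStokesRegularity.Theses.EfficiencyFloor.MaximiserSetRigidity) :
    ∃ c : ℝ, (0 < c ∧ (∀ v : EuclideanSpace ℝ (Fin 3) → EuclideanSpace ℝ (Fin 3), (ContDiff ℝ (⊤ : ℕ∞) v ∧
      VectorCalculus.IsDivFree v ∧ (∫⁻ x, ‖iteratedFDeriv ℝ 0 v x‖ₑ ^ 2 < ⊤) ∧ (∫⁻ x, ‖iteratedFDeriv ℝ 1 v x‖ₑ ^ 2 < ⊤) ∧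
      (∫⁻ x, ‖iteratedFDeriv ℝ 2 v x‖ₑ ^ 2 < ⊤)) → (∫ x, ⟪curl v x, fderiv ℝ v x (curl v x)⟫_ℝ) ≤
      c * (∫ x, ‖curl v x‖ ^ 2) ^ (3 / 4 : ℝ) * (∫ x, frobeniusNormSq (fderiv ℝ (curl v) x)) ^ (3 / 4 : ℝ)) ∧
      ∀ c' : ℝ, (∀ w : EuclideanSpace ℝ (Fin 3) → EuclideanSpace ℝ (Fin 3), (ContDiff ℝ (⊤ : ℕ∞) w ∧
      VectorCalculus.IsDivFree w ∧ (∫⁻ x, ‖iteratedFDeriv ℝ 0 w x‖ₑ ^ 2 < ⊤) ∧ (∫⁻ x, ‖iteratedFDeriv ℝ 1 w x‖ₑ ^ 2 < ⊤) ∧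
      (∫⁻ x, ‖iteratedFDeriv ℝ 2 w x‖ₑ ^ 2 < ⊤)) → (∫ x, ⟪curl w x, fderiv ℝ w x (curl w x)⟫_ℝ) ≤
      c' * (∫ x, ‖curl w x‖ ^ 2) ^ (3 / 4 : ℝ) * (∫ x, frobeniusNormSq (fderiv ℝ (curl w) x)) ^ (3 / 4 : ℝ)) → c ≤ c') ∧
      ∀ η : ℝ, 0 < η → η < 1 → ∀ (ν T : ℝ), 0 < ν → 0 < T →
      ∀ (u : ℝ → EuclideanSpace ℝ (Fin 3) → EuclideanSpace ℝ (Fin 3)) (p : ℝ → EuclideanSpace ℝ (Fin 3) → ℝ),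
      IsMaximalSmoothSolution ν 0 u p T → IsLerayHopfOn T ν 0 (u 0) u → HasRapidSpatialDecay (u 0) →
      ∃ s₀ ∈ Ioo 0 T, ∀ s ∈ Ico s₀ T, s + η * (64 * ν ^ 3 / (27 * c ^ 4) * (∫ x, ‖curl (u s) x‖ ^ 2)⁻¹ ^ 2) < T →
        ∃ θ : ℝ, 0 < θ ∧ (1 - η + 2 * θ) * (∫ x, ‖curl (u s) x‖ ^ 2)⁻¹ ^ 2 ≤
          (∫ x, ‖curl (u (s + η * (64 * ν ^ 3 / (27 * c ^ 4) * (∫ x, ‖curl (u s) x‖ ^ 2)⁻¹ ^ 2))) x‖ ^ 2)⁻¹ ^ 2 := by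
  obtain ⟨c, hsharp, h⟩ := late_earlyDeficit
  refine ⟨c, hsharp, fun η hη0 hη1 ν T hν hT u p hmax hLH hdec => h η hη0 hη1 ν T hν hT u p hmax hLH hdec ?_⟩
  obtain ⟨k, ms, hms, hclass⟩ := partA_of_maximiserSetRigidity hM c ν hsharp hν
  exact ⟨k, ms, fun i => (hms i).1, hclass⟩

/-- **Strict late Leray floor from the route decl `MaximiserSetRigidity`** BY NAME. [folklore] -/
theorem late_strict_lerayFloor_of_maximiserSetRigidity
    (hM : Summit.NavierStokesRegularity.NavierStokesRegularity.Theses.EfficiencyFloor.MaximiserSetRigidity) :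
    ∃ c : ℝ, (0 < c ∧ (∀ v : EuclideanSpace ℝ (Fin 3) → EuclideanSpace ℝ (Fin 3), (ContDiff ℝ (⊤ : ℕ∞) v ∧
      VectorCalculus.IsDivFree v ∧ (∫⁻ x, ‖iteratedFDeriv ℝ 0 v x‖ₑ ^ 2 < ⊤) ∧ (∫⁻ x, ‖iteratedFDeriv ℝ 1 v x‖ₑ ^ 2 < ⊤) ∧
      (∫⁻ x, ‖iteratedFDeriv ℝ 2 v x‖ₑ ^ 2 < ⊤)) → (∫ x, ⟪curl v x, fderiv ℝ v x (curl v x)⟫_ℝ) ≤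
      c * (∫ x, ‖curl v x‖ ^ 2) ^ (3 / 4 : ℝ) * (∫ x, frobeniusNormSq (fderiv ℝ (curl v) x)) ^ (3 / 4 : ℝ)) ∧
      ∀ c' : ℝ, (∀ w : EuclideanSpace ℝ (Fin 3) → EuclideanSpace ℝ (Fin 3), (ContDiff ℝ (⊤ : ℕ∞) w ∧
      VectorCalculus.IsDivFree w ∧ (∫⁻ x, ‖iteratedFDeriv ℝ 0 w x‖ₑ ^ 2 < ⊤) ∧ (∫⁻ x, ‖iteratedFDeriv ℝ 1 w x‖ₑ ^ 2 < ⊤) ∧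
      (∫⁻ x, ‖iteratedFDeriv ℝ 2 w x‖ₑ ^ 2 < ⊤)) → (∫ x, ⟪curl w x, fderiv ℝ w x (curl w x)⟫_ℝ) ≤
      c' * (∫ x, ‖curl w x‖ ^ 2) ^ (3 / 4 : ℝ) * (∫ x, frobeniusNormSq (fderiv ℝ (curl w) x)) ^ (3 / 4 : ℝ)) → c ≤ c') ∧
      ∀ (ν T : ℝ), 0 < ν → 0 < T →
      ∀ (u : ℝ → EuclideanSpace ℝ (Fin 3) → EuclideanSpace ℝ (Fin 3)) (p : ℝ → EuclideanSpace ℝ (Fin 3) → ℝ),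
      IsMaximalSmoothSolution ν 0 u p T → IsLerayHopfOn T ν 0 (u 0) u → HasRapidSpatialDecay (u 0) →
      ∃ s₀ ∈ Ioo 0 T, ∀ s ∈ Ico s₀ T, (∫ x, ‖curl (u s) x‖ ^ 2)⁻¹ ^ 2 < 2 * (27 * c ^ 4 / (128 * ν ^ 3)) * (T - s) := by
  obtain ⟨c, hsharp, h⟩ := late_strict_lerayFloor
  refine ⟨c, hsharp, fun ν T hν hT u p hmax hLH hdec => h ν T hν hT u p hmax hLH hdec ?_⟩
  obtain ⟨k, ms, hms, hclass⟩ := partA_of_maximiserSetRigidity hM c ν hsharp hν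
  exact ⟨k, ms, fun i => (hms i).1, hclass⟩

end LateExit

end RigidExit

end Summit.NavierStokesRegularity.NavierStokesRegularity.Theorems

end
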